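import Mathlib
import Summits.MatrixMultiplication.MatrixMultiplication.Theorems.SubgroupIdentityDesigns.Negative.DesignTranslate

/-!
# Conjugation and monotonicity of level-one identity designs on `GL₂(𝔽_p)`
(negative-side lemma for the crux `SubgroupIdentityDesigns`, stmt-MatrixMultiplication-14079; cell B2b-5, gen 8)

The exact census of the cell `(m,k,p) = (2,1,11)` (reports `run/shared/lean/b2b/levelgraded-cu/ORACLE-g7.md`,
`ORACLE-g8.md`; engine `g7.c`, mode `g7enum`) enumerates subgroup triples `(H₁,H₂,H₃)` of `GL₂(𝔽₁₁)` only up to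
SIMULTANEOUS CONJUGATION: `H₁` a conjugacy-class representative, `H₃` canonical under `N(H₁)`, `H₂` canonical under
`N(H₁) ∩ N(H₃)`.  This file makes that reduction a theorem about the literal identity-design clause of the crux at
`(m,k) = (2,1)`:

* `design_transport_fourierMat` — if every element of `Kᵢ` is `x h x⁻¹` with `h ∈ Hᵢ` (one `x ∈ GL₂(𝔽_p)` for all
  three), a level-one identity design `c` for `(H₁,H₂,H₃)` yields one for `(K₁,K₂,K₃)`, namely `M ↦ c(x⁻¹ M x)`
  (`f ↦ f(x⁻¹ · x)`; level one by `fourierMat_translate` / `rank_conj_eq`).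
* `design_transport` — the same for the crux's inlined clause; with `x = 1` it is MONOTONICITY (`design_mono`:
  sub-triples of a design triple are design triples), with `Kᵢ = x Hᵢ x⁻¹` CONJUGATION INVARIANCE (`design_conj`).
Sorry-free; standard axioms.  VALUE = a theorem making a census reduction kernel-sound, NOT summit progress; the
crux item stays open.
-/

set_option linter.dupNamespace false

noncomputable section

open scoped BigOperators Classical
open Summit.MatrixMultiplication.MatrixMultiplication.Theorems.LieRankDesigns.Negative (GLm Mat)

namespace Summit.MatrixMultiplication.MatrixMultiplication.Theorems.SubgroupIdentityDesigns.Negative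

namespace DesignConj

variable {p : ℕ} [Fact p.Prime]

/-- **TRANSPORT (Fourier form).**  If `Kᵢ ⊆ x Hᵢ x⁻¹` (`i = 1,2,3`, one `x`) and `c` is a level-one identity design
for `(H₁,H₂,H₃)`, then `M ↦ c(x⁻¹ M x)` is one for `(K₁,K₂,K₃)`. -/
theorem design_transport_fourierMat {H₁ H₂ H₃ K₁ K₂ K₃ : Subgroup (GLm p 2)} (x : GLm p 2)
    (hK₁ : ∀ k ∈ K₁, x⁻¹ * k * x ∈ H₁) (hK₂ : ∀ k ∈ K₂, x⁻¹ * k * x ∈ H₂)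
    (hK₃ : ∀ k ∈ K₃, x⁻¹ * k * x ∈ H₃) (c : Mat p 2 → ℂ) (hc : ∀ M : Mat p 2, 1 < M.rank → c M = 0)
    (h1 : fourierMat c 1 = 1)
    (h0 : ∀ a ∈ H₁, ∀ b ∈ H₂, ∀ g ∈ H₃, a * b * g ≠ 1 → fourierMat c ((a * b * g : GLm p 2) : Mat p 2) = 0) :
    let c' : Mat p 2 → ℂ := fun M => c (((x⁻¹ : GLm p 2) : Mat p 2) * M * (x : Mat p 2))
    (∀ M : Mat p 2, 1 < M.rank → c' M = 0) ∧ fourierMat c' 1 = 1 ∧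
      ∀ a ∈ K₁, ∀ b ∈ K₂, ∀ g ∈ K₃, a * b * g ≠ 1 → fourierMat c' ((a * b * g : GLm p 2) : Mat p 2) = 0 := by
  intro c'
  have hA : (x : Mat p 2) * ((x⁻¹ : GLm p 2) : Mat p 2) = 1 := by
    rw [← Units.val_mul, mul_inv_cancel, Units.val_one]
  have htr : ∀ s : Mat p 2, fourierMat c' s = fourierMat c (((x⁻¹ : GLm p 2) : Mat p 2) * s * (x : Mat p 2)) :=
    fun s => fourierMat_translate c _ _ _ _ hA hA s
  refine ⟨?_, ?_, ?_⟩
  · intro M hM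
    apply hc
    rwa [rank_conj_eq M (x : Mat p 2) ((x⁻¹ : GLm p 2) : Mat p 2) (Matrix.isUnit_det_of_right_inverse hA)
      (Matrix.isUnit_det_of_left_inverse hA)]
  · rw [htr, mul_one, ← Units.val_mul, inv_mul_cancel, Units.val_one, h1]
  · intro a ha b hb g hg hne
    rw [htr]
    have hval : ((x⁻¹ : GLm p 2) : Mat p 2) * ((a * b * g : GLm p 2) : Mat p 2) * (x : Mat p 2) =
        (((x⁻¹ * a * x) * (x⁻¹ * b * x) * (x⁻¹ * g * x) : GLm p 2) : Mat p 2) := by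
      rw [show x⁻¹ * a * x * (x⁻¹ * b * x) * (x⁻¹ * g * x) = x⁻¹ * (a * b * g) * x by group]
      simp only [Units.val_mul]
    rw [hval]
    refine h0 _ (hK₁ a ha) _ (hK₂ b hb) _ (hK₃ g hg) ?_
    intro h1'
    apply hne
    have : a * b * g = x * (x⁻¹ * a * x * (x⁻¹ * b * x) * (x⁻¹ * g * x)) * x⁻¹ := by group
    rw [this, h1', mul_one, mul_inv_cancel]

/-- **TRANSPORT (crux clause).**  If `Kᵢ ⊆ x Hᵢ x⁻¹` (`i = 1,2,3`, one `x`), the literal `(2,1)` identity-design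
clause of `SubgroupIdentityDesigns` for `(H₁,H₂,H₃)` implies the one for `(K₁,K₂,K₃)`. -/
theorem design_transport {H₁ H₂ H₃ K₁ K₂ K₃ : Subgroup (GLm p 2)} (x : GLm p 2)
    (hK₁ : ∀ k ∈ K₁, x⁻¹ * k * x ∈ H₁) (hK₂ : ∀ k ∈ K₂, x⁻¹ * k * x ∈ H₂)
    (hK₃ : ∀ k ∈ K₃, x⁻¹ * k * x ∈ H₃)
    (h : ∃ c : Matrix (Fin 2) (Fin 2) (ZMod p) → ℂ, (∀ M, 1 < M.rank → c M = 0) ∧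
      (∑ M, c M * ZMod.stdAddChar (Matrix.trace (M * ((1 : GLm p 2) : Mat p 2)))) = 1 ∧
      ∀ a ∈ H₁, ∀ b ∈ H₂, ∀ g ∈ H₃, a * b * g ≠ 1 →
        (∑ M, c M * ZMod.stdAddChar (Matrix.trace (M * ((a * b * g : GLm p 2) : Mat p 2)))) = 0) :
    ∃ c : Matrix (Fin 2) (Fin 2) (ZMod p) → ℂ, (∀ M, 1 < M.rank → c M = 0) ∧
      (∑ M, c M * ZMod.stdAddChar (Matrix.trace (M * ((1 : GLm p 2) : Mat p 2)))) = 1 ∧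
      ∀ a ∈ K₁, ∀ b ∈ K₂, ∀ g ∈ K₃, a * b * g ≠ 1 →
        (∑ M, c M * ZMod.stdAddChar (Matrix.trace (M * ((a * b * g : GLm p 2) : Mat p 2)))) = 0 := by
  obtain ⟨c, hc, h1, h0⟩ := h
  have h1' : fourierMat c 1 = 1 := by simpa only [fourierMat, Units.val_one] using h1
  obtain ⟨hc', h1'', h0''⟩ := design_transport_fourierMat x hK₁ hK₂ hK₃ c hc h1' h0
  exact ⟨_, hc', by simpa only [fourierMat, Units.val_one] using h1'', h0''⟩

/-- **MONOTONICITY.**  Sub-triples of a design triple are design triples. -/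
theorem design_mono {H₁ H₂ H₃ K₁ K₂ K₃ : Subgroup (GLm p 2)} (h₁ : K₁ ≤ H₁) (h₂ : K₂ ≤ H₂) (h₃ : K₃ ≤ H₃)
    (h : ∃ c : Matrix (Fin 2) (Fin 2) (ZMod p) → ℂ, (∀ M, 1 < M.rank → c M = 0) ∧
      (∑ M, c M * ZMod.stdAddChar (Matrix.trace (M * ((1 : GLm p 2) : Mat p 2)))) = 1 ∧
      ∀ a ∈ H₁, ∀ b ∈ H₂, ∀ g ∈ H₃, a * b * g ≠ 1 →
        (∑ M, c M * ZMod.stdAddChar (Matrix.trace (M * ((a * b * g : GLm p 2) : Mat p 2)))) = 0) :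
    ∃ c : Matrix (Fin 2) (Fin 2) (ZMod p) → ℂ, (∀ M, 1 < M.rank → c M = 0) ∧
      (∑ M, c M * ZMod.stdAddChar (Matrix.trace (M * ((1 : GLm p 2) : Mat p 2)))) = 1 ∧
      ∀ a ∈ K₁, ∀ b ∈ K₂, ∀ g ∈ K₃, a * b * g ≠ 1 →
        (∑ M, c M * ZMod.stdAddChar (Matrix.trace (M * ((a * b * g : GLm p 2) : Mat p 2)))) = 0 :=
  design_transport 1 (fun k hk => by simpa using h₁ hk) (fun k hk => by simpa using h₂ hk)
    (fun k hk => by simpa using h₃ hk) h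

/-- **CONJUGATION INVARIANCE.**  The design clause for `(H₁,H₂,H₃)` implies the one for the simultaneously
conjugated triple `(x H₁ x⁻¹, x H₂ x⁻¹, x H₃ x⁻¹)` (`Subgroup.map (MulAut.conj x)`); apply with `x⁻¹` for the
converse. -/
theorem design_conj (H₁ H₂ H₃ : Subgroup (GLm p 2)) (x : GLm p 2)
    (h : ∃ c : Matrix (Fin 2) (Fin 2) (ZMod p) → ℂ, (∀ M, 1 < M.rank → c M = 0) ∧
      (∑ M, c M * ZMod.stdAddChar (Matrix.trace (M * ((1 : GLm p 2) : Mat p 2)))) = 1 ∧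
      ∀ a ∈ H₁, ∀ b ∈ H₂, ∀ g ∈ H₃, a * b * g ≠ 1 →
        (∑ M, c M * ZMod.stdAddChar (Matrix.trace (M * ((a * b * g : GLm p 2) : Mat p 2)))) = 0) :
    ∃ c : Matrix (Fin 2) (Fin 2) (ZMod p) → ℂ, (∀ M, 1 < M.rank → c M = 0) ∧
      (∑ M, c M * ZMod.stdAddChar (Matrix.trace (M * ((1 : GLm p 2) : Mat p 2)))) = 1 ∧
      ∀ a ∈ H₁.map (MulAut.conj x).toMonoidHom, ∀ b ∈ H₂.map (MulAut.conj x).toMonoidHom,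
        ∀ g ∈ H₃.map (MulAut.conj x).toMonoidHom, a * b * g ≠ 1 →
        (∑ M, c M * ZMod.stdAddChar (Matrix.trace (M * ((a * b * g : GLm p 2) : Mat p 2)))) = 0 := by
  have fwd : ∀ (H : Subgroup (GLm p 2)), ∀ k ∈ H.map (MulAut.conj x).toMonoidHom, x⁻¹ * k * x ∈ H := by
    intro H k hk
    obtain ⟨h, hh, rfl⟩ := Subgroup.mem_map.mp hk
    simpa [MulAut.conj_apply, mul_assoc] using hh
  exact design_transport x (fwd H₁) (fwd H₂) (fwd H₃) h

end DesignConj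

end Summit.MatrixMultiplication.MatrixMultiplication.Theorems.SubgroupIdentityDesigns.Negative
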